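import Mathlib.Analysis.SpecialFunctions.Sqrt
import Mathlib.Analysis.SpecialFunctions.Pow.Real
import Literature.MathematicalPhysics.KineticTheory.TwoTemperatureEuler
import Literature.Analysis.FluidPDE.LoadedSphereDynamics
import HarnessLib

/-!
# The Enskog translation–rotation exchange rate of Jeans' loaded spheres

Topic `Literature/MathematicalPhysics/KineticTheory` (definition item `defn-loadedExchangeRate`, wanted by
route item `TwoTemperatureRung` of `JeansLoadedDice`, `AtomisticToContinuum/HydrodynamicLimit`).
Companion of `TwoTemperatureEuler.lean` (the parameter `c` of `IsTwoTemperatureEulerSolution σ κ c …`,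
`exchangeSource κ c ρ θtr θrot = κ² c(ρ, θtr, θrot) ρ (θtr − θrot)`, `IsExchangeRate c`) and of
`LoadedSphereDynamics.lean` (the impact map `loadedImpact` of two smooth loaded spheres).

## What is formalised

* `hsContactFactor η` — ENSKOG'S FACTOR `χ(η)` (contact value of the pair correlation) of the hard-sphere
  gas at reduced density `η = nσ³`, read off the tree's equation of state `hsCompressibility` through the
  virial (contact-value) theorem `Z = 1 + (2π/3) η χ` — Chapman–Cowling's `p = knT(1 + bρχ)`,
  `bρ = (2π/3) n σ³` (16.51,2); `χ = 1` for a rare gas (16.21). No new statics: a loaded sphere has the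
  hard-sphere excluded volume on its GEOMETRIC centre.
* `hsCollisionRate σ ρ θ = 4√π χ(ρσ³) ρ σ² √θ` — the Enskog collision frequency per particle in the
  conjunct's macroscopic units, with the divergent factor `(N+1)^{1/3}` taken out: `N + 1` spheres of
  diameter `ε_N = hsDiameter σ N = σ(N+1)^{-1/3}` at normalised density `ρ` (number density `(N+1)ρ`) and
  temperature `θ` (unit mass) collide `ν_N = χ · (N+1)ρ · ε_N² · 4√(πθ) = (N+1)^{1/3} · hsCollisionRate σ ρ θ`
  times per unit time each (Chapman–Cowling 5.21,1: `N₁₁/n₁ = 4 n σ² (πkT/m)^{1/2}`, times `χ` in a dense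
  gas, §16.2; `(N+1) ε_N² = (N+1)^{1/3} σ²`, `succ_mul_hsDiameter_sq`).
* `loadedExchangeRate σ ι ρ θtr θrot = (16√π/(3ι)) χ(ρσ³) ρ σ² √θtr = (4/(3ι)) · hsCollisionRate σ ρ θtr`
  — the ENSKOG TRANSLATION–ROTATION EXCHANGE-RATE FUNCTION `c(ρ, θtr, θrot)` of loaded spheres with
  reduced moment of inertia `ι` (inertia `ιε²` about the mass centre), AT LEADING ORDER IN THE
  ECCENTRICITY `ξ`; independent of `θrot` at this order. The Enskog average it abbreviates is derived
  below from the impact map (`rotEnergy_loadedImpact_fst/snd`).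
* `loadedEccentricity κ N = κ (N+1)^{-1/6}` — the eccentricity sequence `ξ_N` of the two-temperature rung,
  with the bookkeeping identity `ξ_N² (N+1)^{1/3} = κ²` (`loadedEccentricity_sq_mul_rpow`): `O(ξ²)` energy
  exchanged per contact times `(N+1)^{1/3}` contacts per unit time is the `O(1)` rate `κ² c`.

## The Enskog average (derivation of the closed form)

Units of the conjunct: `N + 1` unit-mass spheres of diameter `ε = ε_N` on the unit torus, mass centre at
`ξε a` from the geometric centre (`a ∈ S²` the load direction), inertia `ιε²` about the mass centre,
angular momentum `L`, `ω = L/(ιε²)`; two ACTIVE rotational degrees of freedom (the axial spin is inert: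
`inner_loadedImpact_snd_fst`), so the active rotational energy at rotational temperature `θrot` is `θrot`
per particle and `ρθrot` per unit volume. A contact with unit normal `n` (from `i` to `j`) and data
`p = ((Vᵢ, Vⱼ), (Lᵢ, Lⱼ))` has approach speed `g = approachSpeed ε ξ ι aᵢ aⱼ n p = g₀ + ξ(sᵢ − sⱼ)`,
`g₀ = ⟪n, Vᵢ − Vⱼ⟫`, `sᵢ = ε(ιε²)⁻¹⟪Lᵢ, aᵢ × n⟫ = ε⟪n, ωᵢ × aᵢ⟫` (`approachSpeed_eq`), impulse
`J = 2g/D`, `D = 2 + (ξ²/ι) S`, `S = Sᵢ + Sⱼ`, `Sᵢ = ‖aᵢ × n‖² = 1 − ⟪aᵢ, n⟫²`, and the active rotational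
energy gained by the two partners is (`rotEnergy_loadedImpact_fst`, `rotEnergy_loadedImpact_snd`)
`ΔEᵢ = −ξ J sᵢ + ξ² J² Sᵢ/(2ι)`, `ΔEⱼ = +ξ J sⱼ + ξ² J² Sⱼ/(2ι)`.

THE STATE (spatially homogeneous two-temperature Enskog ansatz): geometric centres at number density
`(N+1)ρ` with contact factor `χ(ρσ³)`; `Vᵢ, Vⱼ` independent Maxwellian at `θtr`; `Lᵢ, Lⱼ` independent
centred Gaussian with covariance `ιε²θrot` on the components orthogonal to `aᵢ, aⱼ`; `aᵢ, aⱼ, n` Haar.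
The rate at which particle `i` suffers contacts with parameters `(n, aⱼ, Vⱼ, Lⱼ)` is
`χ (N+1)ρ ε² (g)₊ dn × (law of the partner)` — Chapman–Cowling 16.2,1 with the flux of the MATERIAL
contact points, `(g)₊` and not `(g₀)₊` (incoming iff `g > 0`, `IsLoadedIncoming`).

THE AVERAGE. Conditionally on `(n, aᵢ, aⱼ)`: `g₀ ~ N(0, 2θtr)`, `sᵢ ~ N(0, θrot Sᵢ/ι)`,
`sⱼ ~ N(0, θrot Sⱼ/ι)` independent, so `v := Var g = 2θtr + ξ²θrot S/ι`, `E[sᵢ | g] = ξ(θrot Sᵢ/ι) g/v`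
(Gaussian regression — the `O(ξ)` correlation that produces detailed balance) and
`E[(g)₊³] = v^{3/2} √(2/π)`; hence, exactly within the ansatz,
`E[(g)₊ ΔEᵢ | n, aᵢ, aⱼ] = (2ξ²Sᵢ/(ιD)) √(2v/π) (v/D − θrot) = (4ξ²Sᵢ/(ιD²)) √(2v/π) (θtr − θrot)`,
which vanishes iff `θtr = θrot` and equals `2ξ² √(θtr/π) (Sᵢ/ι)(θtr − θrot) + O(ξ⁴)`; the flux is
`E[(g)₊] = √(v/(2π)) = √(θtr/π) + O(ξ²)` and the Haar average of `Sᵢ = 1 − ⟪aᵢ, n⟫²` is `2/3`. So each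
particle gains active rotational energy at the rate
`χ(N+1)ρε² ∫_{S²} E[(g)₊ ΔEᵢ] dn = ν_N · (4/(3ι)) ξ² (θtr − θrot) · (1 + O(ξ²))`,
`ν_N = (N+1)^{1/3} hsCollisionRate σ ρ θtr`, and the active rotational energy density changes through
contacts at the rate `ρ ν_N (4/(3ι)) ξ² (θtr − θrot)(1 + O(ξ²))`. Along `ξ = ξ_N = loadedEccentricity κ N`,
`ξ_N² (N+1)^{1/3} = κ²`, this tends to `κ² · (4/(3ι)) hsCollisionRate σ ρ θtr · ρ (θtr − θrot)
= exchangeSource κ (loadedExchangeRate σ ι) ρ θtr θrot` (`exchangeSource_loadedExchangeRate`): the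
closed form `c = (16√π/(3ι)) χ(ρσ³) ρσ² √θtr`. (With the wrong flux `(g₀)₊` one would get the
one-signed `ξ²√(θtr/π)(Sᵢ/ι)(2θtr − θrot)`, violating detailed balance.) The same structure
`dθrot/dt = (16√π/3) · (coupling) · nσ²χ√θtr · (θtr − θrot)` holds for Bryan's perfectly rough spheres
with the coupling `K/(1+K)²`, `K = 4I/(mσ²)`, in place of `ξ²/ι` (Huthmann–Zippelius 1997, the rate
equations at `e = β = 1` with `γ = (16/3)σ²n g(σ)√(π/M)`; cf. `LandauTellerEuler.lean`); for the BGK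
closure of Arima–Ruggeri–Sugiyama, `κ² c = 3/(5 τ_KR)` (`exchangeSource`).

## Regularity and sign (honest hypotheses)

`hsCompressibility` is a `limsup`/`deriv` with no regularity in the tree, so smoothness of `c` is proved
UNDER an explicit hypothesis on the equation of state: `contDiffOn_loadedExchangeRate` (`Z` of class `Cⁿ`
on a set `s ∌ 0` ⇒ `c` jointly `Cⁿ` where `ρσ³ ∈ s`, `θtr > 0`), its local form
`contDiffOn_loadedExchangeRate_of_Ioo` (`s = (0, η₀)`, the dilute window where the virial series
converges), and `isExchangeRate_loadedExchangeRate` (`IsExchangeRate (loadedExchangeRate σ ι)` for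
`σ, ι > 0` if `Z` is smooth and `χ > 0` on `(0, ∞)` — NOT claimed unconditionally). Positivity:
`loadedExchangeRate_pos` wherever `χ(ρσ³) > 0` (`hsContactFactor_pos_iff`: iff `Z(ρσ³) > 1`).

## References

* S. Chapman, T. G. Cowling, *The Mathematical Theory of Non-uniform Gases*, 3rd ed. (1970): §5.21 eq. (1)
  p. 90 (collision frequency `4nσ²(πkT/m)^{1/2}`); §11.1 p. 199 (the loaded sphere: "a smooth elastic
  sphere whose mass-centre does not coincide with its geometrical centre", Jeans 1901/1904); §16.2–16.21
  pp. 273–274 (Enskog: collision probability multiplied by the factor `χ`, `χ = 1` for a rare gas,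
  `χ = 1 + (5/8)bρ + …`); §16.51 eq. (2) p. 284 (`p = knT(1 + bρχ)`). [ChapmanCowling1970]
* C. Cox, R. Feres, DCDS-A 36 (2016), §2.4 (the impact map; here through `loadedImpact`). [CoxFeres2016]
* J. S. Dahler, N. F. Sather, J. Chem. Phys. 38 (1963) 2363; S. I. Sandler, J. S. Dahler, J. Chem. Phys. 43
  (1965) 1750 (kinetic theory of loaded spheres I–II, translation–rotation exchange at Boltzmann/Enskog
  level; paywalled, acq-02642 — the rate is RE-DERIVED here from the tree's impact map, not transcribed).
  [DahlerSather1963] [SandlerDahler1965]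
* T. Arima, T. Ruggeri, M. Sugiyama, Phys. Rev. E 96 (2017) 042143, §5.5 (BGK production terms,
  `κ² c = 3/(5τ_KR)`). [ArimaRuggeriSugiyama2017]
* M. Huthmann, A. Zippelius, Phys. Rev. E 56 (1997) R6275 = arXiv:cond-mat/9708093, the two rate
  equations for `T_tr, T_rot` with `γ = (16/3)a²n₀g(a)√(π/M)`, `η_t = k(1+β)/(2(1+k))` (rough-sphere
  analogue; read in the arXiv version). [HuthmannZippelius1997]
-/

noncomputable section

open Set Real
open scoped ContDiff InnerProductSpace

namespace Literature.MathematicalPhysics.KineticTheory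

/-! ### Enskog's contact factor and the collision frequency at fixed reduced density -/

/-- ENSKOG'S FACTOR `χ(η)` of the hard-sphere gas at reduced density `η = nσ³` (the contact value of the
pair correlation, by which the collision probability of a dense gas is multiplied; `χ = 1` for a rare
gas), read off the equation of state `Z = hsCompressibility` through the virial theorem
`Z(η) = 1 + (2π/3) η χ(η)` — Chapman–Cowling's `p = knT(1 + bρχ)` with `bρ = (2π/3) nσ³`. Junk value `0`
at `η = 0` (division by zero; the physical limit is `χ → 1`). [cite: ChapmanCowling1970, §16.51 eq. (2) p. 284 and §16.21 p. 274] -/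
def hsContactFactor (η : ℝ) : ℝ :=
  (hsCompressibility η - 1) / (2 * π / 3 * η)

/-- The ENSKOG COLLISION FREQUENCY per particle with the factor `(N+1)^{1/3}` removed: `N + 1` hard (or
loaded) spheres of diameter `ε_N = hsDiameter σ N` at normalised density `ρ` and temperature `θ` (unit
mass) collide `ν_N = χ(ρσ³) · (N+1)ρ ε_N² · 4√(πθ) = (N+1)^{1/3} · hsCollisionRate σ ρ θ` times per unit time
each (`4nσ²(πkT/m)^{1/2}` of a rare gas times Enskog's `χ`; `(N+1)ε_N² = (N+1)^{1/3}σ²`).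
[cite: ChapmanCowling1970, §5.21 eq. (1) p. 90 and §16.2 p. 273] -/
def hsCollisionRate (σ ρ θ : ℝ) : ℝ :=
  4 * √π * hsContactFactor (ρ * σ ^ 3) * ρ * σ ^ 2 * √θ

/-- The ENSKOG TRANSLATION–ROTATION EXCHANGE-RATE FUNCTION `c(ρ, θtr, θrot)` of Jeans' loaded spheres
(reduced diameter `σ`, reduced moment of inertia `ι`) at leading order in the eccentricity:
`c = (16√π/(3ι)) χ(ρσ³) ρ σ² √θtr = (4/(3ι)) ν`, `ν = hsCollisionRate σ ρ θtr`. It abbreviates the Enskog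
average of the module docstring: in the homogeneous two-temperature state (geometric centres at density
`ρ` with contact factor `χ(ρσ³)`, Maxwellian mass-centre velocities at `θtr`, Gaussian active angular
momenta at `θrot`, Haar load directions), with the incoming flux `(g)₊` of the material contact points
and the rotational energy gain `ΔEᵢ = −ξJsᵢ + ξ²J²Sᵢ/(2ι)` of `loadedImpact` (`rotEnergy_loadedImpact_fst`),
`E[(g)₊ΔEᵢ | n,aᵢ,aⱼ] = (4ξ²Sᵢ/(ιD²))√(2v/π)(θtr − θrot) = 2ξ²√(θtr/π)(Sᵢ/ι)(θtr − θrot) + O(ξ⁴)`,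
`E[Sᵢ] = 2/3`, so the active rotational energy density `ρθrot` changes through contacts at the rate
`ρ ν_N (4/(3ι)) ξ² (θtr − θrot)(1 + O(ξ²))`, i.e. `κ² c ρ (θtr − θrot) = exchangeSource κ c ρ θtr θrot`
along `ξ_N = loadedEccentricity κ N` (`ξ_N²(N+1)^{1/3} = κ²`). Independent of `θrot` at this order (the
third argument is a dummy, kept for the signature of `IsTwoTemperatureEulerSolution`). DERIVED HERE from
the tree's impact map and Enskog's collision ansatz (Chapman–Cowling §16.2) for Jeans' model (§11.1);
the Boltzmann/Enskog kinetic theory of loaded spheres is Dahler–Sather 1963 / Sandler–Dahler 1965 (not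
transcribed: paywalled, unread). [cite: ChapmanCowling1970, §16.2 p. 273 and §11.1 p. 199] -/
def loadedExchangeRate (σ ι : ℝ) : ℝ → ℝ → ℝ → ℝ := fun ρ θtr _ =>
  16 * √π / (3 * ι) * hsContactFactor (ρ * σ ^ 3) * ρ * σ ^ 2 * √θtr

/-- The ECCENTRICITY SEQUENCE `ξ_N = κ (N+1)^{-1/6}` of the two-temperature rung: `O(ξ_N²)` rotational
energy exchanged per contact times `≍ (N+1)^{1/3}` contacts per particle per unit time gives the `O(1)`
exchange rate `κ² c` (`loadedEccentricity_sq_mul_rpow`). [folklore] -/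
def loadedEccentricity (κ : ℝ) (N : ℕ) : ℝ :=
  κ * ((N + 1 : ℕ) : ℝ) ^ (-(1 / 6 : ℝ))

/-! ### Unfolding and algebra -/

/-- Unfolding `hsContactFactor`. [cite: ChapmanCowling1970, §16.51 eq. (2) p. 284] -/
theorem hsContactFactor_def (η : ℝ) :
    hsContactFactor η = (hsCompressibility η - 1) / (2 * π / 3 * η) :=
  rfl

/-- The virial (contact-value) theorem in the form it is used: `Z(η) = 1 + (2π/3) η χ(η)` for `η ≠ 0`.
[cite: ChapmanCowling1970, §16.51 eq. (2) p. 284] -/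
theorem hsCompressibility_eq_contactFactor {η : ℝ} (hη : η ≠ 0) :
    hsCompressibility η = 1 + 2 * π / 3 * η * hsContactFactor η := by
  have h : 2 * π / 3 * η ≠ 0 := mul_ne_zero (by positivity) hη
  rw [hsContactFactor, mul_div_cancel₀ _ h]
  ring

/-- Chapman–Cowling's dense-gas pressure law `p = knT(1 + bρχ)`, `bρ = (2π/3)nσ³`, in the conjunct's
units: `hsPressure σ ρ θ = ρθ(1 + (2π/3) ρσ³ χ(ρσ³))` (for `ρσ³ ≠ 0`).
[cite: ChapmanCowling1970, §16.51 eq. (2) p. 284] -/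
theorem hsPressure_eq_contactFactor {σ ρ : ℝ} (h : ρ * σ ^ 3 ≠ 0) (θ : ℝ) :
    hsPressure σ ρ θ = ρ * θ * (1 + 2 * π / 3 * (ρ * σ ^ 3) * hsContactFactor (ρ * σ ^ 3)) := by
  rw [hsPressure, hsCompressibility_eq_contactFactor h]

/-- `χ(η) > 0` iff `Z(η) > 1` (for `η > 0`). [cite: ChapmanCowling1970, §16.21 p. 274] -/
theorem hsContactFactor_pos_iff {η : ℝ} (hη : 0 < η) :
    0 < hsContactFactor η ↔ 1 < hsCompressibility η := by
  rw [hsContactFactor, div_pos_iff_of_pos_right (by positivity), sub_pos]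

/-- Unfolding `hsCollisionRate`. [cite: ChapmanCowling1970, §5.21 eq. (1) p. 90] -/
theorem hsCollisionRate_def (σ ρ θ : ℝ) :
    hsCollisionRate σ ρ θ = 4 * √π * hsContactFactor (ρ * σ ^ 3) * ρ * σ ^ 2 * √θ :=
  rfl

/-- Unfolding `loadedExchangeRate`: the closed form `c = (16√π/(3ι)) χ(ρσ³) ρσ² √θtr`.
[cite: ChapmanCowling1970, §16.2 p. 273] -/
theorem loadedExchangeRate_apply (σ ι ρ θtr θrot : ℝ) :
    loadedExchangeRate σ ι ρ θtr θrot = 16 * √π / (3 * ι) * hsContactFactor (ρ * σ ^ 3) * ρ * σ ^ 2 * √θtr :=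
  rfl

/-- `c = (4/(3ι)) ν`: the exchange rate is `4/(3ι)` times the reduced Enskog collision frequency (mean
active rotational energy `(4/(3ι)) ξ² (θtr − θrot)` gained per particle per collision, to leading order).
[cite: ChapmanCowling1970, §5.21 eq. (1) p. 90] -/
theorem loadedExchangeRate_eq_collisionRate (σ ι ρ θtr θrot : ℝ) :
    loadedExchangeRate σ ι ρ θtr θrot = 4 / (3 * ι) * hsCollisionRate σ ρ θtr := by
  simp only [loadedExchangeRate, hsCollisionRate]
  ring

/-- The exchange rate does not depend on the rotational temperature at this order. [folklore] -/
theorem loadedExchangeRate_rot_indep (σ ι ρ θtr θrot θrot' : ℝ) :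
    loadedExchangeRate σ ι ρ θtr θrot = loadedExchangeRate σ ι ρ θtr θrot' :=
  rfl

/-- THE RATE EQUATION the closed form encodes: with `c = loadedExchangeRate σ ι` the exchange source of
the two-temperature system is `κ² · ρ · ν · (4/(3ι)) (θtr − θrot)` — density times collision frequency
times mean active rotational energy gained per collision over `ξ²`, times `ξ_N²(N+1)^{1/3} = κ²`.
[cite: ArimaRuggeriSugiyama2017, §5.5] -/
theorem exchangeSource_loadedExchangeRate (σ ι κ ρ θtr θrot : ℝ) :
    exchangeSource κ (loadedExchangeRate σ ι) ρ θtr θrot =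
      κ ^ 2 * ρ * hsCollisionRate σ ρ θtr * (4 / (3 * ι) * (θtr - θrot)) := by
  rw [exchangeSource, loadedExchangeRate_eq_collisionRate]
  ring

/-- The exchange vanishes on the equilibrium manifold `θtr = θrot` (automatic from the factor
`θtr − θrot`; detailed balance of the Enskog average). [cite: ArimaRuggeriSugiyama2017, §5.5] -/
theorem exchangeSource_loadedExchangeRate_self (σ ι κ ρ θ : ℝ) :
    exchangeSource κ (loadedExchangeRate σ ι) ρ θ θ = 0 :=
  exchangeSource_self κ _ ρ θ

/-! ### Sign and regularity (under explicit hypotheses on the equation of state) -/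

/-- POSITIVITY on the physical octant: for `σ, ι, ρ, θtr > 0` the exchange rate is positive wherever
Enskog's factor is, `χ(ρσ³) > 0` (i.e. `Z(ρσ³) > 1`, `hsContactFactor_pos_iff`; true for the hard-sphere
gas, whose virial coefficients are positive at low density, but a hypothesis here since
`hsCompressibility` is an abstract `limsup`/`deriv`). [cite: ChapmanCowling1970, §16.21 p. 274] -/
theorem loadedExchangeRate_pos {σ ι ρ θtr : ℝ} (hσ : 0 < σ) (hι : 0 < ι) (hρ : 0 < ρ) (hθtr : 0 < θtr)
    (hχ : 0 < hsContactFactor (ρ * σ ^ 3)) (θrot : ℝ) : 0 < loadedExchangeRate σ ι ρ θtr θrot := by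
  rw [loadedExchangeRate_apply]
  positivity

/-- `χ` inherits the regularity of the equation of state away from `η = 0`. [folklore] -/
theorem contDiffOn_hsContactFactor {n : WithTop ℕ∞} {s : Set ℝ} (hZ : ContDiffOn ℝ n hsCompressibility s)
    (h0 : (0 : ℝ) ∉ s) : ContDiffOn ℝ n hsContactFactor s := by
  have hden : ContDiffOn ℝ n (fun η : ℝ => 2 * π / 3 * η) s := by fun_prop
  refine ContDiffOn.congr ((hZ.sub contDiffOn_const).div hden fun η hη => ?_) fun η _ => rfl
  exact mul_ne_zero (by positivity) fun h => h0 (h ▸ hη)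

/-- JOINT SMOOTHNESS of `(ρ, θtr, θrot) ↦ c(ρ, θtr, θrot)` UNDER a regularity hypothesis on the equation
of state: if `Z = hsCompressibility` is `Cⁿ` on a set `s` not containing `0`, then `c` is jointly `Cⁿ` on
`{ρσ³ ∈ s, θtr > 0}` (`√` is smooth away from `0`; `θrot` is a dummy). [folklore] -/
theorem contDiffOn_loadedExchangeRate {n : WithTop ℕ∞} {s : Set ℝ}
    (hZ : ContDiffOn ℝ n hsCompressibility s) (h0 : (0 : ℝ) ∉ s) (σ ι : ℝ) :
    ContDiffOn ℝ n (fun q : ℝ × ℝ × ℝ => loadedExchangeRate σ ι q.1 q.2.1 q.2.2)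
      {q | q.1 * σ ^ 3 ∈ s ∧ 0 < q.2.1} := by
  have hχ : ContDiffOn ℝ n (fun q : ℝ × ℝ × ℝ => hsContactFactor (q.1 * σ ^ 3))
      {q : ℝ × ℝ × ℝ | q.1 * σ ^ 3 ∈ s ∧ 0 < q.2.1} :=
    (contDiffOn_hsContactFactor hZ h0).comp (by fun_prop) fun q hq => hq.1
  have hsq : ContDiffOn ℝ n (fun q : ℝ × ℝ × ℝ => √(q.2.1)) {q : ℝ × ℝ × ℝ | q.1 * σ ^ 3 ∈ s ∧ 0 < q.2.1} :=
    ContDiffOn.sqrt (by fun_prop) fun q hq => hq.2.ne'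
  have hρ : ContDiffOn ℝ n (fun q : ℝ × ℝ × ℝ => q.1) {q : ℝ × ℝ × ℝ | q.1 * σ ^ 3 ∈ s ∧ 0 < q.2.1} := by
    fun_prop
  exact (((contDiffOn_const.mul hχ).mul hρ).mul contDiffOn_const).mul hsq

/-- The LOCAL form used by the route: if the equation of state is smooth on the dilute window `(0, η₀)`
(where the virial series converges), then for `σ > 0` the exchange rate is jointly smooth on
`{0 < ρ, ρσ³ < η₀, θtr > 0, θrot > 0}`. [folklore] -/
theorem contDiffOn_loadedExchangeRate_of_Ioo {σ η₀ : ℝ} (hσ : 0 < σ)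
    (hZ : ContDiffOn ℝ ∞ hsCompressibility (Ioo 0 η₀)) (ι : ℝ) :
    ContDiffOn ℝ ∞ (fun q : ℝ × ℝ × ℝ => loadedExchangeRate σ ι q.1 q.2.1 q.2.2)
      {q | 0 < q.1 ∧ q.1 * σ ^ 3 < η₀ ∧ 0 < q.2.1 ∧ 0 < q.2.2} :=
  (contDiffOn_loadedExchangeRate hZ (by simp) σ ι).mono fun _ ⟨h1, h2, h3, _⟩ =>
    ⟨⟨mul_pos h1 (pow_pos hσ 3), h2⟩, h3⟩

/-- `IsExchangeRate (loadedExchangeRate σ ι)` for `σ, ι > 0` UNDER the global hypotheses that the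
equation of state is smooth and Enskog's factor positive on `(0, ∞)` (jointly smooth and positive on the
physical octant; NOT claimed unconditionally — `hsCompressibility` carries no regularity in the tree).
[cite: ArimaRuggeriSugiyama2017, §5.5] -/
theorem isExchangeRate_loadedExchangeRate {σ ι : ℝ} (hσ : 0 < σ) (hι : 0 < ι)
    (hZ : ContDiffOn ℝ ∞ hsCompressibility (Ioi 0)) (hχ : ∀ η : ℝ, 0 < η → 0 < hsContactFactor η) :
    IsExchangeRate (loadedExchangeRate σ ι) := by
  refine ⟨(contDiffOn_loadedExchangeRate hZ (by simp) σ ι).mono ?_, fun ρ θtr θrot hρ hθtr _ => ?_⟩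
  · rintro q ⟨h1, h2, -⟩
    exact ⟨mem_Ioi.2 (mul_pos h1 (pow_pos hσ 3)), h2⟩
  · exact loadedExchangeRate_pos hσ hι hρ hθtr (hχ _ (mul_pos hρ (pow_pos hσ 3))) θrot

/-! ### Scaling bookkeeping -/

/-- Unfolding `loadedEccentricity`. [folklore] -/
theorem loadedEccentricity_def (κ : ℝ) (N : ℕ) :
    loadedEccentricity κ N = κ * ((N + 1 : ℕ) : ℝ) ^ (-(1 / 6 : ℝ)) :=
  rfl

/-- THE BOOKKEEPING IDENTITY of the two-temperature rung: `ξ_N² (N+1)^{1/3} = κ²` for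
`ξ_N = κ(N+1)^{-1/6}`. [folklore] -/
theorem loadedEccentricity_sq_mul_rpow (κ : ℝ) (N : ℕ) :
    loadedEccentricity κ N ^ 2 * ((N + 1 : ℕ) : ℝ) ^ (1 / 3 : ℝ) = κ ^ 2 := by
  have hN : (0 : ℝ) < ((N + 1 : ℕ) : ℝ) := by positivity
  rw [loadedEccentricity, mul_pow, ← Real.rpow_natCast (((N + 1 : ℕ) : ℝ) ^ (-(1 / 6 : ℝ))) 2,
    ← Real.rpow_mul hN.le, mul_assoc, ← Real.rpow_add hN]
  norm_num

/-- The same identity with the eccentricity written out, `(κ(N+1)^{-1/6})² (N+1)^{1/3} = κ²`. [folklore] -/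
theorem sq_rpow_neg_sixth_mul_rpow_third (κ : ℝ) (N : ℕ) :
    (κ * ((N + 1 : ℕ) : ℝ) ^ (-(1 / 6 : ℝ))) ^ 2 * ((N + 1 : ℕ) : ℝ) ^ (1 / 3 : ℝ) = κ ^ 2 :=
  loadedEccentricity_sq_mul_rpow κ N

/-- `ξ_N` is positive for `κ > 0`. [folklore] -/
theorem loadedEccentricity_pos {κ : ℝ} (hκ : 0 < κ) (N : ℕ) : 0 < loadedEccentricity κ N :=
  mul_pos hκ (Real.rpow_pos_of_pos (by positivity) _)

/-- `ξ_N ≤ κ` for `κ ≥ 0` (so `ξ_N < 1/2`, the admissible range of `LoadedSphereFlow`, once `κ < 1/2`).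
[folklore] -/
theorem loadedEccentricity_le {κ : ℝ} (hκ : 0 ≤ κ) (N : ℕ) : loadedEccentricity κ N ≤ κ := by
  refine mul_le_of_le_one_right hκ (Real.rpow_le_one_of_one_le_of_nonpos ?_ (by norm_num))
  exact_mod_cast Nat.succ_pos N

/-- `ξ_N → 0`: the eccentricity sequence tends to zero. [folklore] -/
theorem tendsto_loadedEccentricity (κ : ℝ) :
    Filter.Tendsto (fun N => loadedEccentricity κ N) Filter.atTop (nhds 0) := by
  have h : Filter.Tendsto (fun N : ℕ => ((N + 1 : ℕ) : ℝ) ^ (-(1 / 6 : ℝ))) Filter.atTop (nhds 0) := by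
    have h1 : Filter.Tendsto (fun x : ℝ => x ^ (-(1 / 6 : ℝ))) Filter.atTop (nhds 0) :=
      tendsto_rpow_neg_atTop (by norm_num)
    have h2 : Filter.Tendsto (fun N : ℕ => ((N + 1 : ℕ) : ℝ)) Filter.atTop Filter.atTop :=
      tendsto_natCast_atTop_atTop.comp (Filter.tendsto_add_atTop_nat 1)
    exact h1.comp h2
  simpa [loadedEccentricity] using h.const_mul κ

/-- Fixed reduced density, second moment: `(N+1) ε_N² = (N+1)^{1/3} σ²` — the number of partners times the
cross-section grows like `(N+1)^{1/3}`, whence `ν_N = (N+1)^{1/3} · hsCollisionRate σ ρ θ`.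
[cite: ChapmanCowling1970, §5.21 eq. (1) p. 90] -/
theorem succ_mul_hsDiameter_sq (σ : ℝ) (N : ℕ) :
    ((N + 1 : ℕ) : ℝ) * hsDiameter σ N ^ 2 = ((N + 1 : ℕ) : ℝ) ^ (1 / 3 : ℝ) * σ ^ 2 := by
  have hN : (0 : ℝ) < ((N + 1 : ℕ) : ℝ) := by positivity
  have h : ((N + 1 : ℕ) : ℝ) ^ (1 / 3 : ℝ) =
      ((N + 1 : ℕ) : ℝ) * ((N + 1 : ℕ) : ℝ) ^ (-(1 / 3 : ℝ) * ((2 : ℕ) : ℝ)) := by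
    rw [← Real.rpow_one_add' hN.le (by norm_num)]
    norm_num
  rw [hsDiameter, mul_pow, ← Real.rpow_natCast (((N + 1 : ℕ) : ℝ) ^ (-(1 / 3 : ℝ))) 2,
    ← Real.rpow_mul hN.le, h]
  ring

/-- The microscopic Enskog collision frequency equals `(N+1)^{1/3}` times the reduced one:
`χ(ρσ³) · (N+1)ρ · ε_N² · 4√π√θ = (N+1)^{1/3} · hsCollisionRate σ ρ θ`.
[cite: ChapmanCowling1970, §5.21 eq. (1) p. 90 and §16.2 p. 273] -/
theorem enskog_collisionFrequency_eq (σ ρ θ : ℝ) (N : ℕ) :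
    hsContactFactor (ρ * σ ^ 3) * (((N + 1 : ℕ) : ℝ) * ρ) * hsDiameter σ N ^ 2 * (4 * √π * √θ) =
      ((N + 1 : ℕ) : ℝ) ^ (1 / 3 : ℝ) * hsCollisionRate σ ρ θ := by
  have h := succ_mul_hsDiameter_sq σ N
  simp only [hsCollisionRate]
  linear_combination hsContactFactor (ρ * σ ^ 3) * ρ * (4 * √π * √θ) * h

/-! ### Reading the exchange off the impact map -/

section Impact

open Literature.Analysis.FluidPDE

variable {ε ι : ℝ}

/-- ACTIVE ROTATIONAL ENERGY GAINED BY SPHERE `i` in a loaded-sphere impact (inertia `ιε²`):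
`‖Lᵢ'‖²/(2ιε²) − ‖Lᵢ‖²/(2ιε²) = −ξ J sᵢ + ξ² J² ‖aᵢ × n‖²/(2ι)` with `J = impulse …` and the spin speed
`sᵢ = ε(ιε²)⁻¹⟪Lᵢ, aᵢ × n⟫ = ε⟪n, ωᵢ × aᵢ⟫` (the `i`-part of `approachSpeed − g₀`, `approachSpeed_eq`);
`‖aᵢ × n‖² = 1 − ⟪aᵢ, n⟫²` for unit vectors (`norm_cross_sq_of_norm_eq_one`). [cite: CoxFeres2016, §2.4 Def. 5] -/
theorem rotEnergy_loadedImpact_fst (hε : ε ≠ 0) (hι : ι ≠ 0) (ξ : ℝ) (ai aj n : V3)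
    (p : (V3 × V3) × (V3 × V3)) :
    ‖(loadedImpact ε ξ ι ai aj n p).2.1‖ ^ 2 / (2 * (ι * ε ^ 2)) - ‖p.2.1‖ ^ 2 / (2 * (ι * ε ^ 2)) =
      -(ξ * impulse ε ξ ι ai aj n p * (ε * (ι * ε ^ 2)⁻¹ * ⟪p.2.1, cross ai n⟫_ℝ)) +
        ξ ^ 2 * impulse ε ξ ι ai aj n p ^ 2 * ‖cross ai n‖ ^ 2 / (2 * ι) := by
  simp only [loadedImpact, norm_sub_sq_real, real_inner_smul_right, norm_smul, mul_pow, Real.norm_eq_abs,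
    sq_abs]
  field_simp
  ring

/-- ACTIVE ROTATIONAL ENERGY GAINED BY THE PARTNER `j`:
`‖Lⱼ'‖²/(2ιε²) − ‖Lⱼ‖²/(2ιε²) = +ξ J sⱼ + ξ² J² ‖aⱼ × n‖²/(2ι)`, `sⱼ = ε(ιε²)⁻¹⟪Lⱼ, aⱼ × n⟫`; with
`rotEnergy_loadedImpact_fst` the pair gains `−ξJ(sᵢ − sⱼ) + ξ²J²S/(2ι)`, `S = ‖aᵢ × n‖² + ‖aⱼ × n‖²`,
where `g = g₀ + ξ(sᵢ − sⱼ)` (`approachSpeed_eq`). [cite: CoxFeres2016, §2.4 Def. 5] -/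
theorem rotEnergy_loadedImpact_snd (hε : ε ≠ 0) (hι : ι ≠ 0) (ξ : ℝ) (ai aj n : V3)
    (p : (V3 × V3) × (V3 × V3)) :
    ‖(loadedImpact ε ξ ι ai aj n p).2.2‖ ^ 2 / (2 * (ι * ε ^ 2)) - ‖p.2.2‖ ^ 2 / (2 * (ι * ε ^ 2)) =
      ξ * impulse ε ξ ι ai aj n p * (ε * (ι * ε ^ 2)⁻¹ * ⟪p.2.2, cross aj n⟫_ℝ) +
        ξ ^ 2 * impulse ε ξ ι ai aj n p ^ 2 * ‖cross aj n‖ ^ 2 / (2 * ι) := by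
  simp only [loadedImpact, norm_add_sq_real, real_inner_smul_right, norm_smul, mul_pow, Real.norm_eq_abs,
    sq_abs]
  field_simp
  ring

/-- The approach speed splits as `g = g₀ + ξ(sᵢ − sⱼ)` with the spin speeds of the two energy lemmas.
[cite: CoxFeres2016, §2.4] -/
theorem approachSpeed_eq_spin (ξ : ℝ) (ai aj n : V3) (p : (V3 × V3) × (V3 × V3)) :
    approachSpeed ε ξ ι ai aj n p = ⟪n, p.1.1 - p.1.2⟫_ℝ +
      ξ * (ε * (ι * ε ^ 2)⁻¹ * ⟪p.2.1, cross ai n⟫_ℝ - ε * (ι * ε ^ 2)⁻¹ * ⟪p.2.2, cross aj n⟫_ℝ) := by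
  rw [approachSpeed_eq]
  ring

end Impact

end Literature.MathematicalPhysics.KineticTheory

end
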